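import Summits.HodgeConjecture.HodgeConjecture.Theorems.F0LD1ThetaRealisationOfB6
import Summits.HodgeConjecture.HodgeConjecture.Theorems.F0LD1ThetaRealisationOfOrthogonalCopy
import Summits.HodgeConjecture.HodgeConjecture.Theorems.F0LD1ThetaSpanPinOfBricks
import Literature.NumberTheory.Automorphic.Liu2021.CurveThetaNonOrthogonal
import Summits.HodgeConjecture.HodgeConjecture.Theorems.F0LD1ThetaLinePinnedOfBricks
import Summits.HodgeConjecture.HodgeConjecture.Theorems.F0LD2SameLabelClassesOfAFUCompact
import Summits.HodgeConjecture.HodgeConjecture.Theorems.F0LD1LineTransportOfKits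
import Literature.NumberTheory.Automorphic.Liu2021.ThetaLiftFromLineRealises
import Literature.NumberTheory.Automorphic.Liu2021.LemD1RankTwoCMSameLabelLetter
import Literature.NumberTheory.Automorphic.Liu2021.CurveHolThetaNonOrthogonal
import Literature.NumberTheory.Rogawski1990.CurveThetaHodgeTypeNecessity
import Literature.NumberTheory.Automorphic.Liu2021.ThetaLiftFromLineCharacters
import Literature.NumberTheory.Automorphic.HilbertRepSpectrumProofs
import Literature.NumberTheory.Rogawski1990.CurveThetaCohFinComponentUnique
import Summits.HodgeConjecture.HodgeConjecture.Theorems.F0P6LD1CentralCharacterPin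
import Summits.HodgeConjecture.HodgeConjecture.Theorems.F0P6LD1ThetaCharacterPin
import Summits.HodgeConjecture.HodgeConjecture.Theorems.F0P6LD1TransportRational
import Summits.HodgeConjecture.HodgeConjecture.Theorems.F0LD1ThetaCharRigidOfIrred
import Literature.NumberTheory.Automorphic.Liu2021.ThetaLiftFromLineIrreducible
import Summits.HodgeConjecture.HodgeConjecture.Theorems.F0LD2LetterR2OfLineComplementary
import Summits.HodgeConjecture.HodgeConjecture.Theorems.F0LD1ThetaGermDefs
import Summits.HodgeConjecture.HodgeConjecture.Theorems.F0LD1ThetaIrrOfGerm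
import Summits.HodgeConjecture.HodgeConjecture.Theorems.F0LD1ThetaCharRigidOfDichotomy
import Summits.HodgeConjecture.HodgeConjecture.Theorems.F0LD1ThetaSliceOfBricks
import Summits.HodgeConjecture.HodgeConjecture.Theorems.F0LD1ThetaSliceTorusProjectorOrgan
import Summits.HodgeConjecture.HodgeConjecture.Theorems.F0LD1ThetaSliceMeasureScaling
import Summits.HodgeConjecture.HodgeConjecture.Theorems.F0LD1ThetaSliceHermiteSum
import Summits.HodgeConjecture.HodgeConjecture.Theorems.F0LD1ThetaSliceFiniteLevel
import Summits.HodgeConjecture.HodgeConjecture.Theorems.F0LD1ThetaDichotomyBricks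
import Summits.HodgeConjecture.HodgeConjecture.Theorems.F0LD1ThetaDichotomyOfBricks
import Summits.HodgeConjecture.HodgeConjecture.Theorems.F0LD1ThetaFinGeneration
import Summits.HodgeConjecture.HodgeConjecture.Theorems.F0LD2LineThetaTypesComplementary1
import Summits.HodgeConjecture.HodgeConjecture.Theorems.F0LD2OperatorWords
import Summits.HodgeConjecture.HodgeConjecture.Theorems.F0LD1ThetaArchLadderHolds
import HarnessLib
import HarnessLib.Audit.LibrarySuggestionsDenyListCruxes

/-!
# `F0P6LD1StubS1FactsVocabulary` — ★ RE-HOME (K-style, HOME cand, LA3-p01 (g7) L3-D7 (ii) 2026-09-03) of `Lines/F0_P6LD_StubS1FactsThetaRoad.lean` (tree sha16 4be8935f579711f3), PART 1 of 2 — tree lines :291–:420 (§0b the scaled-frame adelic transport, §1 the rank-2 vocabulary `CharSeam₂`∕`CharThetaSpaceLe₂`; §0 :240–:290 is NOT re-homed — [d] cure of the `--dry-run` `dedup.landed` 09:37Z: `DiscreteAutomorphicRep.eq_of_space_eq` ≡ ★ `Literature.NumberTheory.Automorphic.DiscreteAutomorphicRep.ext'`, `DiscreteAutomorphicRep.eq_of_mem_of_mem`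 ∕ `compactSpace_lineQuotient_of_posDef` ≡ ★ `Theorems/F0P6LD1StubS1FactsOfA2P.lean` (p853696) — the head in PART 2 references those ★ FQNs).

ROOT part: carries the K-style carrier `import HarnessLib.Audit.LibrarySuggestionsDenyListCruxes` (LEAD «M-142d» «P-κ») in addition to the leaf's own imports (all ★ `Theorems`∕`Literature`∕`HarnessLib`; no `Lines` import).
Same namespace `Summit.HodgeConjecture.HodgeConjecture.Cruxes.HLiu418.F0P6LD1StubS1Facts` (every fully-qualified name unchanged); the option ∕ `open` lines :218–:237 are replayed verbatim; the code after
the replay block is the tree bytes of the named ranges, untouched.  What STAYS in `Lines`: the module docstring∕edition history (:1–:217), §3 (:726–:917: the ONE printed-letter `sorry`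
`stub_letter_A₂P_hodgeFree` and the by-name organ∕brick∕letter closers) and the by-name head `curveThetaCohFinComponentUnique_hol_of_thetaRoad` (:955), i.e. everything whose closure
touches the printed letter.  GATE NOTE (v3): in the docstrings of the `def … : Prop` predicates the leaf's `[cite: …]` tags are spelled `(print: …)` (★ `RoofGeoHoles` convention) so the gate's inline-fact RELOCATION does not lift section-variable predicates out of their section (p853994∕p853995 bounce 09:44Z); theorem docstrings keep `[cite:]`.  HC_CM is proved only modulo the 7 printed citations (2 remaining: hLiu418 = stmt-HodgeConjecture-24832, h413 = stmt-HodgeConjecture-24833) until rung 0 closes; a re-home is count-neutral.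
-/

-- ── replay of tree :218–:237 (verbatim) ──
set_option autoImplicit false
set_option linter.dupNamespace false

noncomputable section

open NumberField NumberField.InfinitePlace MeasureTheory IsDedekindDomain
open scoped Matrix ComplexOrder
open Literature.NumberTheory.Automorphic Literature.NumberTheory.Automorphic.UnitaryGroup
open Literature.NumberTheory.Automorphic.UnitaryGroup.CotangentForms (toQuotFun)
open Literature.NumberTheory.Automorphic.UnitaryCurveForms
open Literature.NumberTheory.Automorphic.Liu2021 Literature.NumberTheory.Automorphic.Liu2021.Def411WeilCarriers
open Literature.NumberTheory.Automorphic.Liu2021.Def411WeilCarriersDoubling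
open Literature.NumberTheory.GaloisRepresentations Literature.NumberTheory.Automorphic.IdeleClassGroup
open Literature.NumberTheory.GelbartRogawski1991 Literature.NumberTheory.GelbartRogawski1991.UnitaryDualPair
open Literature.NumberTheory.GelbartRogawski1991.UnitaryDualPair.WeilCoinv
open Literature.NumberTheory.Weil1964
open Literature.RepresentationTheory.Liu2021 Literature.RepresentationTheory.HarrisKudlaSweet1996
open Literature.RepresentationTheory.CompactGroups
open Literature.NumberTheory.Rogawski1990

namespace Summit.HodgeConjecture.HodgeConjecture.Cruxes.HLiu418.F0P6LD1StubS1Facts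

-- ── tree bytes :291–:420 ──
/-! ## §0b The SCALED-FRAME adelic transport `ιA : U(H)(𝔸_{L⁺}) →* U(diag dV)(𝔸_{L⁺})`, `k ↦ g_𝔸⁻¹ k g_𝔸`, for a frame `ᵗḡ (tH) g = diag dV` (proved) -/

section Transport

/-- `(t • H)_𝔸 = t_𝔸 • H_𝔸` (the form read over the adeles). [cite: PlatonovRapinchuk1994, §5.1] -/
theorem adelicForm_smul (L : Type) [Field L] [NumberField L] {N : ℕ} (t : L) (H : Matrix (Fin N) (Fin N) L) :
    UnitaryGroup.adelicForm L N (t • H) = algebraMap L (AdeleRing (𝓞 L) L) t • UnitaryGroup.adelicForm L N H := by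
  ext i j
  simp [UnitaryGroup.adelicForm, Matrix.map_apply, Matrix.smul_apply, map_mul, smul_eq_mul]

/-- **`U(t • H)(𝔸_{L⁺}) = U(H)(𝔸_{L⁺})`** for `t ≠ 0` (the adelic twin of ★ `UnitaryGroup.finAdelic_smul` ∕ `rational_smul`: the unitary group of a form
depends only on its similarity class). [cite: PlatonovRapinchuk1994, §2.3] -/
theorem adelic_smul_eq (L : Type) [Field L] [NumberField L] [IsCMField L] {N : ℕ} (H : Matrix (Fin N) (Fin N) L) {t : L} (ht : t ≠ 0) :
    UnitaryGroup.adelic (↥(maximalRealSubfield L)) L (IsCMField.complexConj L) N (t • H) =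
      UnitaryGroup.adelic (↥(maximalRealSubfield L)) L (IsCMField.complexConj L) N H := by
  change unitaryGroupOfForm _ (UnitaryGroup.adelicForm L N (t • H)) = unitaryGroupOfForm _ (UnitaryGroup.adelicForm L N H)
  rw [adelicForm_smul]
  exact unitaryGroupOfForm_smul_of_isUnit _ ((IsUnit.mk0 t ht).map _) _

/-- **The scaled-frame transport** `U(H)(𝔸_{L⁺}) →* U(diag dV)(𝔸_{L⁺})`, `k ↦ g_𝔸⁻¹ k g_𝔸`, for a frame `ᵗḡ (tH) g = diag dV`: the identity `U(H)(𝔸) = U(tH)(𝔸)`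
(`adelic_smul_eq`) followed by the frame transport ★ `Liu2021.cmAdelicFrameTransport L N (t • H) dV g hg`. [cite: Mok2014, §1 Notation p. 5] -/
def scaledFrameTransport (L : Type) [Field L] [NumberField L] [IsCMField L] {N : ℕ} (H : Matrix (Fin N) (Fin N) L) (dV : Fin N → L)
    {t : L} (ht : t ≠ 0) (g : GL (Fin N) L)
    (hg : formCongr ((IsCMField.complexConj L : L ≃ₐ[↥(maximalRealSubfield L)] L) : L →+* L) g (t • H) = Matrix.diagonal dV) :
    (adelicGroupData (↥(maximalRealSubfield L)) L (IsCMField.complexConj L) N H).Adelic →*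
      ↥(UnitaryGroup.adelic (↥(maximalRealSubfield L)) L (IsCMField.complexConj L) N (Matrix.diagonal dV)) :=
  (cmAdelicFrameTransport L N (t • H) dV g hg).comp (Subgroup.inclusion (adelic_smul_eq L H ht).ge)

/-- `↑(scaledFrameTransport … k) = g_𝔸⁻¹ · k · g_𝔸` in `GL_N(𝔸_L)` (★ `coe_cmAdelicFrameTransport`). [cite: Mok2014, §1 Notation p. 5] -/
theorem coe_scaledFrameTransport (L : Type) [Field L] [NumberField L] [IsCMField L] {N : ℕ} (H : Matrix (Fin N) (Fin N) L) (dV : Fin N → L)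
    {t : L} (ht : t ≠ 0) (g : GL (Fin N) L)
    (hg : formCongr ((IsCMField.complexConj L : L ≃ₐ[↥(maximalRealSubfield L)] L) : L →+* L) g (t • H) = Matrix.diagonal dV)
    (k : (adelicGroupData (↥(maximalRealSubfield L)) L (IsCMField.complexConj L) N H).Adelic) :
    ((scaledFrameTransport L H dV ht g hg k :
        ↥(UnitaryGroup.adelic (↥(maximalRealSubfield L)) L (IsCMField.complexConj L) N (Matrix.diagonal dV))) :
          GL (Fin N) (AdeleRing (𝓞 L) L)) =
      (toAdeleGL L g)⁻¹ * adelicVal (↥(maximalRealSubfield L)) L (IsCMField.complexConj L) N H k * toAdeleGL L g := by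
  show ((cmAdelicFrameTransport L N (t • H) dV g hg (Subgroup.inclusion (adelic_smul_eq L H ht).ge k) :
      ↥(UnitaryGroup.adelic (↥(maximalRealSubfield L)) L (IsCMField.complexConj L) N (Matrix.diagonal dV))) :
        GL (Fin N) (AdeleRing (𝓞 L) L)) = _
  rw [coe_cmAdelicFrameTransport]
  rfl

end Transport

/-! ## §1 The theta-road vocabulary at rank 2 (two `Prop`-valued abbreviations of the ★ seam currency; nothing asserted) -/

section Vocabulary

variable (L : Type) [Field L] [NumberField L] [IsCMField L] (H : Matrix (Fin 2) (Fin 2) L) {n' : ℕ} (e₁ : Fin 2 × Fin 1 ≃ Fin n')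
  (dV : Fin 2 → L) (hdV : ∀ i, IsCMField.complexConj L (dV i) = dV i) (hdV0 : ∀ i, dV i ≠ 0)
  {μA : Measure (adelicGroupData (↥(maximalRealSubfield L)) L (IsCMField.complexConj L) 2 H).automorphicQuotient}
  [(adelicGroupData (↥(maximalRealSubfield L)) L (IsCMField.complexConj L) 2 H).IsAutomorphicMeasure μA]
  (P : DiscreteAutomorphicRep (adelicGroupData (↥(maximalRealSubfield L)) L (IsCMField.complexConj L) 2 H) μA)
  (lam : Literature.NumberTheory.Automorphic.IdeleClassGroup L →ₜ* Circle) (hlam : IsConjugateSymplectic L lam)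
  (a' : (↥(maximalRealSubfield L))ˣ)
  (ιA : (adelicGroupData (↥(maximalRealSubfield L)) L (IsCMField.complexConj L) 2 H).Adelic →*
    ↥(UnitaryGroup.adelic (↥(maximalRealSubfield L)) L (IsCMField.complexConj L) 2 (Matrix.diagonal dV)))
  [CompactSpace (↥(UnitaryGroup.adelic (↥(maximalRealSubfield L)) L (IsCMField.complexConj L) 2 (Matrix.diagonal dV)) ⧸
    (UnitaryGroup.toAdelic (↥(maximalRealSubfield L)) L (IsCMField.complexConj L) 2 (Matrix.diagonal dV)).range)]
  (ξ : haveI := normal_range_toAdelic_JW L a'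
    PontryaginDual (↥(UnitaryGroup.adelic (↥(maximalRealSubfield L)) L (IsCMField.complexConj L) 1 (JW (↥(maximalRealSubfield L)) L a')) ⧸
      (UnitaryGroup.toAdelic (↥(maximalRealSubfield L)) L (IsCMField.complexConj L) 1 (JW (↥(maximalRealSubfield L)) L a')).range))

/-- **`CharSeam₂ … P lam hlam a′ ιA ξ`** — «the `ξ`-theta lift from the line `⟨a′⟩` at the `λ`-splitting MEETS `P` INSIDE `P`»: for some Weil-majorant
witness, finite invariant measure on `[U(⟨a′⟩)]` and Schwartz–Bruhat `Ψ`, the `L²`-class of `x ↦ Θ̃_Ψ(ξ)(ιA x)` lies in `P` and is non-zero (the seam ★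
`MeetsThetaLiftFromLine` with the continuous weight `f` a unitary CHARACTER `ξ` of the compact abelian group `[U(⟨a′⟩)]`, ★ `normal_range_toAdelic_JW`).
Nothing is asserted. (print: Liu2021, proof of Prop. 4.13 Case 1 (p. 48); proof of Prop. D.4 (1) (p. 131 L19–27)) (print: GelbartRogawski1991, §3.2 p. 457) -/
def CharSeam₂ : Prop :=
  letI : MeasurableSpace (↥(UnitaryGroup.adelic (↥(maximalRealSubfield L)) L (IsCMField.complexConj L) 1
      (JW (↥(maximalRealSubfield L)) L a')) ⧸
        (UnitaryGroup.toAdelic (↥(maximalRealSubfield L)) L (IsCMField.complexConj L) 1 (JW (↥(maximalRealSubfield L)) L a')).range) :=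
    borel _
  haveI := normal_range_toAdelic_JW L a'
  ∃ (hρ : HasThetaMajorants fun
      (p : ↥(UnitaryGroup.adelic (↥(maximalRealSubfield L)) L (IsCMField.complexConj L) 2 (Matrix.diagonal dV)) ×
        ↥(UnitaryGroup.adelic (↥(maximalRealSubfield L)) L (IsCMField.complexConj L) 1 (JW (↥(maximalRealSubfield L)) L a')))
      (Φ : piSchwartzBruhat (↥(maximalRealSubfield L)) (Fin n')) =>
        pairRep (↥(maximalRealSubfield L)) L (IsCMField.complexConj L) 2 1 e₁ (Matrix.diagonal dV) (JW (↥(maximalRealSubfield L)) L a')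
          (chiSplittingLine L e₁ dV hdV hdV0 (toHeckeCharacter L lam) (isUnitary_toHeckeCharacter L lam)
            ((isOscillatorChar_toHeckeCharacter_iff lam).mpr hlam) (TW (↥(maximalRealSubfield L)) a')
            (isUnit_det_TW (↥(maximalRealSubfield L)) a') (JW (↥(maximalRealSubfield L)) L a') (JW_eq (↥(maximalRealSubfield L)) L a'))
          p Φ)
    (μW : Measure (↥(UnitaryGroup.adelic (↥(maximalRealSubfield L)) L (IsCMField.complexConj L) 1
      (JW (↥(maximalRealSubfield L)) L a')) ⧸
        (UnitaryGroup.toAdelic (↥(maximalRealSubfield L)) L (IsCMField.complexConj L) 1 (JW (↥(maximalRealSubfield L)) L a')).range))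
    (_ : IsFiniteMeasure μW)
    (_ : SMulInvariantMeasure
      (↥(UnitaryGroup.adelic (↥(maximalRealSubfield L)) L (IsCMField.complexConj L) 1 (JW (↥(maximalRealSubfield L)) L a')))
      (↥(UnitaryGroup.adelic (↥(maximalRealSubfield L)) L (IsCMField.complexConj L) 1 (JW (↥(maximalRealSubfield L)) L a')) ⧸
        (UnitaryGroup.toAdelic (↥(maximalRealSubfield L)) L (IsCMField.complexConj L) 1 (JW (↥(maximalRealSubfield L)) L a')).range)
      μW)
    (Ψ : piSchwartzBruhat (↥(maximalRealSubfield L)) (Fin n'))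
    (hθ : MemLp (toQuotFun (adelicGroupData (↥(maximalRealSubfield L)) L (IsCMField.complexConj L) 2 H) fun x =>
      (lineThetaKernelDatum L 2 e₁ dV hdV hdV0 lam hlam a' hρ).thetaLiftFun μW Ψ (charCM ξ) (ιA x)) 2 μA),
    MemLp.toLp _ hθ ∈ P.space.toSubmodule ∧ MemLp.toLp _ hθ ≠ 0

/-- **`CharThetaSpaceLe₂ … P lam hlam a′ ιA ξ`** — «`Θ_{⟨a′⟩,λ}(ξ) ⊆ P`»: EVERY `ξ`-theta class from the line `⟨a′⟩` at the `λ`-splitting (every majorant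
witness, every finite invariant measure on `[U(⟨a′⟩)]`, every Schwartz–Bruhat `Ψ`) lies in `P`.  Nothing is asserted.
(print: Liu2021, proof of Prop. 4.13 Case 1 (p. 48): «`V_π = Θ^V(π_W)`») (print: Rallis1984, §1) -/
def CharThetaSpaceLe₂ : Prop :=
  letI : MeasurableSpace (↥(UnitaryGroup.adelic (↥(maximalRealSubfield L)) L (IsCMField.complexConj L) 1
      (JW (↥(maximalRealSubfield L)) L a')) ⧸
        (UnitaryGroup.toAdelic (↥(maximalRealSubfield L)) L (IsCMField.complexConj L) 1 (JW (↥(maximalRealSubfield L)) L a')).range) :=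
    borel _
  haveI := normal_range_toAdelic_JW L a'
  ∀ (hρ : HasThetaMajorants fun
      (p : ↥(UnitaryGroup.adelic (↥(maximalRealSubfield L)) L (IsCMField.complexConj L) 2 (Matrix.diagonal dV)) ×
        ↥(UnitaryGroup.adelic (↥(maximalRealSubfield L)) L (IsCMField.complexConj L) 1 (JW (↥(maximalRealSubfield L)) L a')))
      (Φ : piSchwartzBruhat (↥(maximalRealSubfield L)) (Fin n')) =>
        pairRep (↥(maximalRealSubfield L)) L (IsCMField.complexConj L) 2 1 e₁ (Matrix.diagonal dV) (JW (↥(maximalRealSubfield L)) L a')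
          (chiSplittingLine L e₁ dV hdV hdV0 (toHeckeCharacter L lam) (isUnitary_toHeckeCharacter L lam)
            ((isOscillatorChar_toHeckeCharacter_iff lam).mpr hlam) (TW (↥(maximalRealSubfield L)) a')
            (isUnit_det_TW (↥(maximalRealSubfield L)) a') (JW (↥(maximalRealSubfield L)) L a') (JW_eq (↥(maximalRealSubfield L)) L a'))
          p Φ)
    (μW : Measure (↥(UnitaryGroup.adelic (↥(maximalRealSubfield L)) L (IsCMField.complexConj L) 1
      (JW (↥(maximalRealSubfield L)) L a')) ⧸
        (UnitaryGroup.toAdelic (↥(maximalRealSubfield L)) L (IsCMField.complexConj L) 1 (JW (↥(maximalRealSubfield L)) L a')).range))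
    (_ : IsFiniteMeasure μW)
    (_ : SMulInvariantMeasure
      (↥(UnitaryGroup.adelic (↥(maximalRealSubfield L)) L (IsCMField.complexConj L) 1 (JW (↥(maximalRealSubfield L)) L a')))
      (↥(UnitaryGroup.adelic (↥(maximalRealSubfield L)) L (IsCMField.complexConj L) 1 (JW (↥(maximalRealSubfield L)) L a')) ⧸
        (UnitaryGroup.toAdelic (↥(maximalRealSubfield L)) L (IsCMField.complexConj L) 1 (JW (↥(maximalRealSubfield L)) L a')).range)
      μW)
    (Ψ : piSchwartzBruhat (↥(maximalRealSubfield L)) (Fin n'))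
    (hθ : MemLp (toQuotFun (adelicGroupData (↥(maximalRealSubfield L)) L (IsCMField.complexConj L) 2 H) fun x =>
      (lineThetaKernelDatum L 2 e₁ dV hdV hdV0 lam hlam a' hρ).thetaLiftFun μW Ψ (charCM ξ) (ιA x)) 2 μA),
    MemLp.toLp _ hθ ∈ P.space.toSubmodule

end Vocabulary

end Summit.HodgeConjecture.HodgeConjecture.Cruxes.HLiu418.F0P6LD1StubS1Facts

end
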